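import Literature.NumberTheory.Automorphic.QuaternionAlgebraClassification
import Literature.NumberTheory.Automorphic.QuaternionAlgebraHasse
import Literature.NumberTheory.Automorphic.QuaternionAlgebraEmbedding
import Literature.NumberTheory.Automorphic.QuaternionAlgebraAdelicRamificationProofs
import HarnessLib

/-!
# Uniqueness of quaternion algebras with given ramification: the assembled reduction

Glue file for the decomposition of the named fact `nonempty_algEquiv_of_ramifiedPlaces_eq K D` of
`Literature.NumberTheory.Automorphic.QuaternionAlgebraAdelic` (Vignéras, LNM 800, Ch. III §3
Thm. 3.1, uniqueness half: *quaternion algebras over a number field with the same ramification are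
isomorphic*) into the named facts printed as its inputs in the book, everything in between being
proved in the three sibling files:

* `QuaternionAlgebraClassification` — level 1: from local uniqueness at finite places
  (`nonempty_algEquiv_adicCompletion_of_division`, II Thm. 1.1) and the local–global principle
  (`nonempty_algEquiv_of_completions`, III Thm. 3.1) to the target (Frobenius, base change,
  Wedderburn proved);
* `QuaternionAlgebraHasse` — level 2: the local–global principle from Hasse's norm theorem
  (`hilbertSymbol_eq_one_of_forall_completions`, III Cor. 3.4) and common quadratic subfields
  (`exists_common_quadratic_subfield`, III Thm. 3.8 (2)) (Cor. 2.2, rescaling, the local step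
  proved);
* `QuaternionAlgebraEmbedding` — level 3: common quadratic subfields from the embedding criterion
  (`exists_sq_eq_of_not_isSquare_ramified`, III Thm. 3.8 (1)) and finiteness of ramification
  (`ramifiedPlaces_finite`, III §3) (Lemme 3.6 proved in `QuaternionAlgebraSplitting`); the
  finiteness is itself proved in `QuaternionAlgebraAdelicRamificationProofs`
  (`ramifiedPlaces_finite_holds`, Vignéras III §1 Lemme 1.1).

Hence `nonempty_algEquiv_of_ramifiedPlaces_eq_of_leaves`: the target follows from the three
remaining named facts II Thm. 1.1, III Cor. 3.4 and III Thm. 3.8 (1). All declarations here are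
theorems.

## References

* M.-F. Vignéras, *Arithmétique des algèbres de quaternions*, LNM 800 (1980), Ch. II §1 Thm. 1.1;
  Ch. III §3 Thm. 3.1, Cor. 3.4, Lemme 3.6, Thm. 3.8.
-/

noncomputable section

open NumberField IsDedekindDomain

universe u v

namespace Literature.NumberTheory.Automorphic

section NumberField

variable (K : Type) [Field K] [NumberField K] (D : Type u) [Ring D] [Algebra K D]

/-- **Discharge of `nonempty_algEquiv_of_completions` relative to III Cor. 3.4 and Thm. 3.8 (2)**:
the local–global principle for isomorphism of quaternion algebras follows from the named facts
`exists_common_quadratic_subfield K D` and `hilbertSymbol_eq_one_of_forall_completions`, by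
`nonempty_algEquiv_of_completions_of_norm_facts` (`QuaternionAlgebraHasse`).
[cite: VignerasLNM800, Ch. III §3 Thm. 3.1] -/
theorem nonempty_algEquiv_of_completions_of_facts
    (hC : exists_common_quadratic_subfield.{u, v} K D)
    (hN : ∀ a θ : K, hilbertSymbol_eq_one_of_forall_completions K a θ) :
    nonempty_algEquiv_of_completions.{u, v} K D := by
  intro D' _ _ _ _ hf hi
  exact nonempty_algEquiv_of_completions_of_norm_facts K D hC hN D' hf hi

/-- **Vignéras III §3 Thm. 3.1 (uniqueness) from its printed leaves.** The named fact
`nonempty_algEquiv_of_ramifiedPlaces_eq K D` — two quaternion algebras over the number field `K`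
with the same finite and infinite ramification are isomorphic — follows from three named facts:
local uniqueness of the quaternion field at finite places (II Thm. 1.1,
`nonempty_algEquiv_adicCompletion_of_division`), Hasse's norm theorem for quadratic extensions
(III Cor. 3.4, `Literature.NumberTheory.Automorphic.hilbertSymbol_eq_one_of_forall_completions`) and the embedding criterion for
quadratic fields (III Thm. 3.8 (1), `exists_sq_eq_of_not_isSquare_ramified`, for `D` and for the
`D'` compared with it). Frobenius' theorem, base change, Wedderburn's dichotomy, Cor. 2.2,
Cor. 2.4, Lemme 3.6, the finiteness of ramification, the local step and all assemblies are proved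
(this file and its imports). [cite: VignerasLNM800, Ch. III §3 Thm. 3.1] -/
theorem nonempty_algEquiv_of_ramifiedPlaces_eq_of_leaves
    (hL : nonempty_algEquiv_adicCompletion_of_division.{u, v})
    (hN : ∀ a θ : K, hilbertSymbol_eq_one_of_forall_completions K a θ)
    (h38 : exists_sq_eq_of_not_isSquare_ramified K D)
    (h38' : ∀ (D' : Type v) [Ring D'] [Algebra K D'], exists_sq_eq_of_not_isSquare_ramified K D') :
    nonempty_algEquiv_of_ramifiedPlaces_eq.{u, v} K D :=
  nonempty_algEquiv_of_ramifiedPlaces_eq_of_facts K D hL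
    (nonempty_algEquiv_of_completions_of_facts K D
      (exists_common_quadratic_subfield_of_facts K D h38 (ramifiedPlaces_finite_holds K D) h38'
        fun D' _ _ ↦ ramifiedPlaces_finite_holds K D') hN)

end NumberField

end Literature.NumberTheory.Automorphic
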